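import Summits.KontsevichZagierPeriods.KontsevichZagierPeriods.Theorems.UnfoldedLogStokes.Negative.LoadBearingII

/-!
# `LiouvilleUnfolding.UnfoldedLogStokes` (stmt-KontsevichZagierPeriods-2835) — refuted strengthenings

On the HONEST witness G (`[a,b] = [0,1]`, `H = 1`, `H' = 0`, `V = 1 + t`, `V' = 1`; every hypothesis of
the crux holds, `G.spec`) the four representations are `r₁ = [{1 ≤ u ≤ 1+t}, 0]`,
`r₂ = [[1,2], 1/u] = log 2`, `r₃ = [[1,1], 1/u] = 0`, `r₄ = [[0,1], 1/(1+t)] = log 2`, and the crux's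
combination `[r₁] − [r₂] + [r₃] + [r₄]` evaluates to `0` (`G.value_r₂_eq_value_r₄`, the shift `u = 1 + t`
at the level of one-variable integrals).  The natural strengthenings are refuted by soundness:
"the bulk alone is a relation" `[r₁] + [r₄] ∈ KZ.relations` (`not_bulk`: it evaluates to
`∫_τ [H log V]_a^b`), "the boundary alone is a relation" `[r₃] − [r₂] ∈ KZ.relations` (`not_boundary`),
and the opposite orientation of the boundary `[r₁] + [r₂] − [r₃] + [r₄]` (`not_wrongSign`) — the sign
pattern of the crux (value at `b` minus value at `a`, moved to the left) is the right one.
[Kontsevich–Zagier 2001, §1.2] [folklore]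
-/

noncomputable section

open Set MeasureTheory MvPolynomial Filter Topology
open Literature.NumberTheory.Transcendental Literature.ModelTheory.ExponentialFields
open Literature.NumberTheory.Transcendental.SemialgebraicDerivative (sa_atom)
open Summit.KontsevichZagierPeriods.KontsevichZagierPeriods.Theses.LiouvilleUnfolding (UnfoldedLogStokes)

namespace Summit.KontsevichZagierPeriods.LiouvilleUnfolding.UnfoldedLogStokesNegative

/-! ## §3 Refuted natural strengthenings (honest data, wrong conclusions)

Witness G = the HONEST instance `[a,b] = [0,1]`, `H = 1`, `H' = 0`, `V = 1 + t`, `V' = 1`: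
`r₁ = [{1 ≤ u ≤ 1+t}, 0]`, `r₂ = [[1,2], 1/u] = log 2`, `r₃ = [[1,1], 1/u] = 0`,
`r₄ = [[0,1], 1/(1+t)] = log 2`; the crux's combination `r₁ − r₂ + r₃ + r₄ = 0 − log 2 + 0 + log 2`
vanishes, and NO OTHER sign pattern / sub-combination below does. -/

/-- Strengthening "the bulk alone is a relation": `[r₁] + [r₄] ∈ relations`. -/
def Bulk : Prop :=
  ∀ (n : ℕ) (τ : Set (Fin n → ℝ)) (a b : (Fin n → ℝ) → ℝ) (H H' V V' : (Fin (n + 1) → ℝ) → ℝ) (r₁ : Literature.NumberTheory.Transcendental.KZ.IntegralRep (n + 2)) (r₂ r₃ r₄ : Literature.NumberTheory.Transcendental.KZ.IntegralRep (n + 1)), Literature.ModelTheory.ExponentialFields.IsSemialgebraic ℚ τ →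
    Literature.NumberTheory.Transcendental.IsSemialgebraicFunOn ℚ τ a →
    Literature.NumberTheory.Transcendental.IsSemialgebraicFunOn ℚ τ b →
    (∀ x ∈ τ, a x ≤ b x) →
    r₄.domain = {z | (Fin.init z : Fin n → ℝ) ∈ τ ∧ a (Fin.init z) ≤ z (Fin.last n) ∧ z (Fin.last n) ≤ b (Fin.init z)} →
    Literature.NumberTheory.Transcendental.IsSemialgebraicFunOn ℚ r₄.domain H →
    Literature.NumberTheory.Transcendental.IsSemialgebraicFunOn ℚ r₄.domain V →
    (∀ z ∈ r₄.domain, 1 ≤ V z) →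
    (∀ x ∈ τ, ContinuousOn (fun t : ℝ => H (Fin.snoc x t)) (Set.Icc (a x) (b x)) ∧ ContinuousOn (fun t : ℝ => V (Fin.snoc x t)) (Set.Icc (a x) (b x))) →
    (∀ x ∈ τ, ∀ t ∈ Set.Ioo (a x) (b x), HasDerivAt (fun s : ℝ => H (Fin.snoc x s)) (H' (Fin.snoc x t)) t ∧ HasDerivAt (fun s : ℝ => V (Fin.snoc x s)) (V' (Fin.snoc x t)) t) →
    (∀ z ∈ r₄.domain, a (Fin.init z) < z (Fin.last n) → z (Fin.last n) < b (Fin.init z) → r₄.integrand z = H z * V' z / V z) →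
    r₁.domain = {w | (Fin.init w : Fin (n + 1) → ℝ) ∈ r₄.domain ∧ 1 ≤ w (Fin.last (n + 1)) ∧ w (Fin.last (n + 1)) ≤ V (Fin.init w)} →
    (∀ w ∈ r₁.domain, a (Fin.init (Fin.init w)) < Fin.init w (Fin.last n) → Fin.init w (Fin.last n) < b (Fin.init (Fin.init w)) → r₁.integrand w = H' (Fin.init w) / w (Fin.last (n + 1))) →
    r₂.domain = {z | (Fin.init z : Fin n → ℝ) ∈ τ ∧ 1 ≤ z (Fin.last n) ∧ z (Fin.last n) ≤ V (Fin.snoc (Fin.init z) (b (Fin.init z)))} →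
    (∀ z ∈ r₂.domain, r₂.integrand z = H (Fin.snoc (Fin.init z) (b (Fin.init z))) / z (Fin.last n)) →
    r₃.domain = {z | (Fin.init z : Fin n → ℝ) ∈ τ ∧ 1 ≤ z (Fin.last n) ∧ z (Fin.last n) ≤ V (Fin.snoc (Fin.init z) (a (Fin.init z)))} →
    (∀ z ∈ r₃.domain, r₃.integrand z = H (Fin.snoc (Fin.init z) (a (Fin.init z))) / z (Fin.last n)) →
    Literature.NumberTheory.Transcendental.KZ.of r₁ + Literature.NumberTheory.Transcendental.KZ.of r₄ ∈ Literature.NumberTheory.Transcendental.KZ.relations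

/-- Strengthening "the boundary alone is a relation": `[r₃] − [r₂] ∈ relations`. -/
def Boundary : Prop :=
  ∀ (n : ℕ) (τ : Set (Fin n → ℝ)) (a b : (Fin n → ℝ) → ℝ) (H H' V V' : (Fin (n + 1) → ℝ) → ℝ) (r₁ : Literature.NumberTheory.Transcendental.KZ.IntegralRep (n + 2)) (r₂ r₃ r₄ : Literature.NumberTheory.Transcendental.KZ.IntegralRep (n + 1)), Literature.ModelTheory.ExponentialFields.IsSemialgebraic ℚ τ →
    Literature.NumberTheory.Transcendental.IsSemialgebraicFunOn ℚ τ a →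
    Literature.NumberTheory.Transcendental.IsSemialgebraicFunOn ℚ τ b →
    (∀ x ∈ τ, a x ≤ b x) →
    r₄.domain = {z | (Fin.init z : Fin n → ℝ) ∈ τ ∧ a (Fin.init z) ≤ z (Fin.last n) ∧ z (Fin.last n) ≤ b (Fin.init z)} →
    Literature.NumberTheory.Transcendental.IsSemialgebraicFunOn ℚ r₄.domain H →
    Literature.NumberTheory.Transcendental.IsSemialgebraicFunOn ℚ r₄.domain V →
    (∀ z ∈ r₄.domain, 1 ≤ V z) →
    (∀ x ∈ τ, ContinuousOn (fun t : ℝ => H (Fin.snoc x t)) (Set.Icc (a x) (b x)) ∧ ContinuousOn (fun t : ℝ => V (Fin.snoc x t)) (Set.Icc (a x) (b x))) →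
    (∀ x ∈ τ, ∀ t ∈ Set.Ioo (a x) (b x), HasDerivAt (fun s : ℝ => H (Fin.snoc x s)) (H' (Fin.snoc x t)) t ∧ HasDerivAt (fun s : ℝ => V (Fin.snoc x s)) (V' (Fin.snoc x t)) t) →
    (∀ z ∈ r₄.domain, a (Fin.init z) < z (Fin.last n) → z (Fin.last n) < b (Fin.init z) → r₄.integrand z = H z * V' z / V z) →
    r₁.domain = {w | (Fin.init w : Fin (n + 1) → ℝ) ∈ r₄.domain ∧ 1 ≤ w (Fin.last (n + 1)) ∧ w (Fin.last (n + 1)) ≤ V (Fin.init w)} →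
    (∀ w ∈ r₁.domain, a (Fin.init (Fin.init w)) < Fin.init w (Fin.last n) → Fin.init w (Fin.last n) < b (Fin.init (Fin.init w)) → r₁.integrand w = H' (Fin.init w) / w (Fin.last (n + 1))) →
    r₂.domain = {z | (Fin.init z : Fin n → ℝ) ∈ τ ∧ 1 ≤ z (Fin.last n) ∧ z (Fin.last n) ≤ V (Fin.snoc (Fin.init z) (b (Fin.init z)))} →
    (∀ z ∈ r₂.domain, r₂.integrand z = H (Fin.snoc (Fin.init z) (b (Fin.init z))) / z (Fin.last n)) →
    r₃.domain = {z | (Fin.init z : Fin n → ℝ) ∈ τ ∧ 1 ≤ z (Fin.last n) ∧ z (Fin.last n) ≤ V (Fin.snoc (Fin.init z) (a (Fin.init z)))} →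
    (∀ z ∈ r₃.domain, r₃.integrand z = H (Fin.snoc (Fin.init z) (a (Fin.init z))) / z (Fin.last n)) →
    Literature.NumberTheory.Transcendental.KZ.of r₃ - Literature.NumberTheory.Transcendental.KZ.of r₂ ∈ Literature.NumberTheory.Transcendental.KZ.relations

/-- The opposite orientation of the boundary: `[r₁] + [r₂] − [r₃] + [r₄] ∈ relations`. -/
def WrongSign : Prop :=
  ∀ (n : ℕ) (τ : Set (Fin n → ℝ)) (a b : (Fin n → ℝ) → ℝ) (H H' V V' : (Fin (n + 1) → ℝ) → ℝ) (r₁ : Literature.NumberTheory.Transcendental.KZ.IntegralRep (n + 2)) (r₂ r₃ r₄ : Literature.NumberTheory.Transcendental.KZ.IntegralRep (n + 1)), Literature.ModelTheory.ExponentialFields.IsSemialgebraic ℚ τ →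
    Literature.NumberTheory.Transcendental.IsSemialgebraicFunOn ℚ τ a →
    Literature.NumberTheory.Transcendental.IsSemialgebraicFunOn ℚ τ b →
    (∀ x ∈ τ, a x ≤ b x) →
    r₄.domain = {z | (Fin.init z : Fin n → ℝ) ∈ τ ∧ a (Fin.init z) ≤ z (Fin.last n) ∧ z (Fin.last n) ≤ b (Fin.init z)} →
    Literature.NumberTheory.Transcendental.IsSemialgebraicFunOn ℚ r₄.domain H →
    Literature.NumberTheory.Transcendental.IsSemialgebraicFunOn ℚ r₄.domain V →
    (∀ z ∈ r₄.domain, 1 ≤ V z) →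
    (∀ x ∈ τ, ContinuousOn (fun t : ℝ => H (Fin.snoc x t)) (Set.Icc (a x) (b x)) ∧ ContinuousOn (fun t : ℝ => V (Fin.snoc x t)) (Set.Icc (a x) (b x))) →
    (∀ x ∈ τ, ∀ t ∈ Set.Ioo (a x) (b x), HasDerivAt (fun s : ℝ => H (Fin.snoc x s)) (H' (Fin.snoc x t)) t ∧ HasDerivAt (fun s : ℝ => V (Fin.snoc x s)) (V' (Fin.snoc x t)) t) →
    (∀ z ∈ r₄.domain, a (Fin.init z) < z (Fin.last n) → z (Fin.last n) < b (Fin.init z) → r₄.integrand z = H z * V' z / V z) →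
    r₁.domain = {w | (Fin.init w : Fin (n + 1) → ℝ) ∈ r₄.domain ∧ 1 ≤ w (Fin.last (n + 1)) ∧ w (Fin.last (n + 1)) ≤ V (Fin.init w)} →
    (∀ w ∈ r₁.domain, a (Fin.init (Fin.init w)) < Fin.init w (Fin.last n) → Fin.init w (Fin.last n) < b (Fin.init (Fin.init w)) → r₁.integrand w = H' (Fin.init w) / w (Fin.last (n + 1))) →
    r₂.domain = {z | (Fin.init z : Fin n → ℝ) ∈ τ ∧ 1 ≤ z (Fin.last n) ∧ z (Fin.last n) ≤ V (Fin.snoc (Fin.init z) (b (Fin.init z)))} →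
    (∀ z ∈ r₂.domain, r₂.integrand z = H (Fin.snoc (Fin.init z) (b (Fin.init z))) / z (Fin.last n)) →
    r₃.domain = {z | (Fin.init z : Fin n → ℝ) ∈ τ ∧ 1 ≤ z (Fin.last n) ∧ z (Fin.last n) ≤ V (Fin.snoc (Fin.init z) (a (Fin.init z)))} →
    (∀ z ∈ r₃.domain, r₃.integrand z = H (Fin.snoc (Fin.init z) (a (Fin.init z))) / z (Fin.last n)) →
    Literature.NumberTheory.Transcendental.KZ.of r₁ + Literature.NumberTheory.Transcendental.KZ.of r₂ - Literature.NumberTheory.Transcendental.KZ.of r₃ + Literature.NumberTheory.Transcendental.KZ.of r₄ ∈ Literature.NumberTheory.Transcendental.KZ.relations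

namespace G

/-- The representation `r₄ = [band, H V'/V]` of this witness (honest). [folklore] -/
def r₄ : KZ.IntegralRep 1 := r4inv
/-- The representation `r₁ = [{1 ≤ u ≤ V}, H'/u]` of this witness (honest). [folklore] -/
def r₁ : KZ.IntegralRep 2 := F.r₁
/-- The representation `r₂ = [{1 ≤ u ≤ V(b)}, H(b)/u]` of this witness (honest). [folklore] -/
def r₂ : KZ.IntegralRep 1 := F.r₂
/-- The representation `r₃ = [{1 ≤ u ≤ V(a)}, H(a)/u]` of this witness (honest). [folklore] -/
def r₃ : KZ.IntegralRep 1 := F.r₃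

/-- All hypotheses of the crux hold for witness G; any conclusion `P r₁ r₂ r₃ r₄` quantified exactly
like the crux therefore specialises to G. -/
theorem spec {P : ∀ {n : ℕ}, KZ.IntegralRep (n + 2) → KZ.IntegralRep (n + 1) → KZ.IntegralRep (n + 1) →
      KZ.IntegralRep (n + 1) → Prop}
    (h : ∀ (n : ℕ) (τ : Set (Fin n → ℝ)) (a b : (Fin n → ℝ) → ℝ) (H H' V V' : (Fin (n + 1) → ℝ) → ℝ) (r₁ : Literature.NumberTheory.Transcendental.KZ.IntegralRep (n + 2)) (r₂ r₃ r₄ : Literature.NumberTheory.Transcendental.KZ.IntegralRep (n + 1)), Literature.ModelTheory.ExponentialFields.IsSemialgebraic ℚ τ →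
      Literature.NumberTheory.Transcendental.IsSemialgebraicFunOn ℚ τ a →
      Literature.NumberTheory.Transcendental.IsSemialgebraicFunOn ℚ τ b →
      (∀ x ∈ τ, a x ≤ b x) →
      r₄.domain = {z | (Fin.init z : Fin n → ℝ) ∈ τ ∧ a (Fin.init z) ≤ z (Fin.last n) ∧ z (Fin.last n) ≤ b (Fin.init z)} →
      Literature.NumberTheory.Transcendental.IsSemialgebraicFunOn ℚ r₄.domain H →
      Literature.NumberTheory.Transcendental.IsSemialgebraicFunOn ℚ r₄.domain V →
      (∀ z ∈ r₄.domain, 1 ≤ V z) →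
      (∀ x ∈ τ, ContinuousOn (fun t : ℝ => H (Fin.snoc x t)) (Set.Icc (a x) (b x)) ∧ ContinuousOn (fun t : ℝ => V (Fin.snoc x t)) (Set.Icc (a x) (b x))) →
      (∀ x ∈ τ, ∀ t ∈ Set.Ioo (a x) (b x), HasDerivAt (fun s : ℝ => H (Fin.snoc x s)) (H' (Fin.snoc x t)) t ∧ HasDerivAt (fun s : ℝ => V (Fin.snoc x s)) (V' (Fin.snoc x t)) t) →
      (∀ z ∈ r₄.domain, a (Fin.init z) < z (Fin.last n) → z (Fin.last n) < b (Fin.init z) → r₄.integrand z = H z * V' z / V z) →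
      r₁.domain = {w | (Fin.init w : Fin (n + 1) → ℝ) ∈ r₄.domain ∧ 1 ≤ w (Fin.last (n + 1)) ∧ w (Fin.last (n + 1)) ≤ V (Fin.init w)} →
      (∀ w ∈ r₁.domain, a (Fin.init (Fin.init w)) < Fin.init w (Fin.last n) → Fin.init w (Fin.last n) < b (Fin.init (Fin.init w)) → r₁.integrand w = H' (Fin.init w) / w (Fin.last (n + 1))) →
      r₂.domain = {z | (Fin.init z : Fin n → ℝ) ∈ τ ∧ 1 ≤ z (Fin.last n) ∧ z (Fin.last n) ≤ V (Fin.snoc (Fin.init z) (b (Fin.init z)))} →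
      (∀ z ∈ r₂.domain, r₂.integrand z = H (Fin.snoc (Fin.init z) (b (Fin.init z))) / z (Fin.last n)) →
      r₃.domain = {z | (Fin.init z : Fin n → ℝ) ∈ τ ∧ 1 ≤ z (Fin.last n) ∧ z (Fin.last n) ≤ V (Fin.snoc (Fin.init z) (a (Fin.init z)))} →
      (∀ z ∈ r₃.domain, r₃.integrand z = H (Fin.snoc (Fin.init z) (a (Fin.init z))) / z (Fin.last n)) →
      P r₁ r₂ r₃ r₄) : P r₁ r₂ r₃ r₄ := by
  have hV1 : ∀ z ∈ r₄.domain, 1 ≤ Vlin z := fun z hz => by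
    have h1 := (mem_I.1 hz).1
    simp only [Vlin_apply]
    linarith
  have hcont : ∀ x ∈ τ₀, ContinuousOn (fun _ : ℝ => (1 : ℝ)) (Icc 0 1) ∧
      ContinuousOn (fun t : ℝ => Vlin (Fin.snoc x t)) (Icc 0 1) := fun x _ =>
    ⟨continuousOn_const, continuousOn_Vlin x _⟩
  have hder : ∀ x ∈ τ₀, ∀ t ∈ Ioo (0 : ℝ) 1, HasDerivAt (fun _ : ℝ => (1 : ℝ)) 0 t ∧
      HasDerivAt (fun s : ℝ => Vlin (Fin.snoc x s)) 1 t :=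
    fun x _ t _ => ⟨hasDerivAt_const t 1, hasDerivAt_Vlin t x⟩
  have hr₄ : ∀ z ∈ r₄.domain, (0 : ℝ) < z 0 → z 0 < 1 →
      r₄.integrand z = 1 * 1 / Vlin z := fun z _ _ _ => by simp [r₄]
  have hr₁ : ∀ w ∈ r₁.domain, (0 : ℝ) < Fin.init w 0 → Fin.init w 0 < 1 →
      r₁.integrand w = 0 / w (Fin.last 1) := fun w _ _ _ => by simp [r₁, F.r₁, r1zero]
  have hr₂ : ∀ z ∈ r₂.domain, r₂.integrand z = 1 / z 0 := fun z _ => by simp [r₂, F.r₂]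
  have hr₃ : ∀ z ∈ r₃.domain, r₃.integrand z = 1 / z 0 := fun z _ => by simp [r₃, F.r₃]
  exact h 0 τ₀ (fun _ => 0) (fun _ => 1) (fun _ => 1) (fun _ => 0) Vlin (fun _ => 1)
    r₁ r₂ r₃ r₄ sa_τ₀ (sa_zero sa_τ₀) (sa_one sa_τ₀) (fun _ _ => zero_le_one) rfl
    (sa_one sa_I01) (sa_Vlin sa_I01) hV1 hcont hder hr₄ rfl hr₁ rfl hr₂ rfl hr₃

/-- The bulk unfolded representation of witness G has zero integrand, value `0`. [folklore] -/
theorem value_r₁ : r₁.value = 0 := by simp [r₁, F.r₁, r1zero]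
/-- This boundary representation has null domain, value `0`. [folklore] -/
theorem value_r₃ : r₃.value = 0 := F.value_r₃
/-- `[[1,2], 1/u] ≥ 1/2` (it is `log 2`). [folklore] -/
theorem half_le_value_r₂ : 1 / 2 ≤ r₂.value := F.half_le_value_r₂
/-- `[[0,1], 1/(1+t)] ≥ 1/2` (it is `log 2`). [folklore] -/
theorem half_le_value_r₄ : 1 / 2 ≤ r₄.value := half_le_value_r4inv

/-- Sanity: on the honest witness the crux's own combination DOES evaluate to zero
(`0 − log 2 + 0 + log 2`), so G is not a counterexample to the crux — only to its variants. -/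
theorem value_r₂_eq_value_r₄ : r₂.value = r₄.value := by
  -- both are `log 2`: `∫₁² du/u` and `∫₀¹ dt/(1+t)`; we identify them through the `u = 1 + t` shift
  -- performed at the level of one-variable integrals.
  have e := MeasureTheory.volume_preserving_funUnique (Fin 1) ℝ
  have h₂ : r₂.value = ∫ u in Icc (1:ℝ) 2, 1 / u := by
    have hpre : r₂.domain = MeasurableEquiv.funUnique (Fin 1) ℝ ⁻¹' Icc 1 2 := by
      ext z
      show z ∈ Bdry Vlin 1 ↔ _
      rw [Bdry_eq_I Vlin_snoc_one]
      simp [mem_I, MeasurableEquiv.funUnique, Fin.default_eq_zero]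
    show ∫ z in r₂.domain, r₂.integrand z = _
    rw [hpre, ← e.setIntegral_preimage_emb (MeasurableEquiv.measurableEmbedding _)]
    rfl
  have h₄ : r₄.value = ∫ t in Icc (0:ℝ) 1, 1 / (1 + t) := by
    have hpre : r₄.domain = MeasurableEquiv.funUnique (Fin 1) ℝ ⁻¹' Icc 0 1 := by
      ext z
      show z ∈ I 0 1 ↔ _
      simp [mem_I, MeasurableEquiv.funUnique, Fin.default_eq_zero]
    show ∫ z in r₄.domain, r₄.integrand z = _
    rw [hpre, ← e.setIntegral_preimage_emb (MeasurableEquiv.measurableEmbedding _)]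
    rfl
  rw [h₂, h₄, integral_Icc_eq_integral_Ioc, integral_Icc_eq_integral_Ioc,
    ← intervalIntegral.integral_of_le one_le_two, ← intervalIntegral.integral_of_le zero_le_one]
  have key := intervalIntegral.integral_comp_add_left (fun u : ℝ => 1 / u) (1 : ℝ) (a := 0) (b := 1)
  rw [add_zero, show (1 : ℝ) + 1 = 2 by norm_num] at key
  exact key.symm

end G

/-- **The bulk terms alone are not a relation** (`[r₁] + [r₄]` evaluates to `∫_τ [H log V]_a^b`). -/
theorem not_bulk : ¬ Bulk := by
  intro h
  have key : KZ.of G.r₁ + KZ.of G.r₄ ∈ KZ.relations := G.spec (P := fun {_} r₁ _ _ r₄ =>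
    KZ.of r₁ + KZ.of r₄ ∈ KZ.relations) h
  have h0 := KZ.relations_le_ker_eval_holds key
  simp only [AddMonoidHom.mem_ker, map_add, KZ.eval_of, G.value_r₁] at h0
  linarith [G.half_le_value_r₄]

/-- **The boundary terms alone are not a relation.** -/
theorem not_boundary : ¬ Boundary := by
  intro h
  have key : KZ.of G.r₃ - KZ.of G.r₂ ∈ KZ.relations := G.spec (P := fun {_} _ r₂ r₃ _ =>
    KZ.of r₃ - KZ.of r₂ ∈ KZ.relations) h
  have h0 := KZ.relations_le_ker_eval_holds key
  simp only [AddMonoidHom.mem_ker, map_sub, KZ.eval_of, G.value_r₃] at h0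
  linarith [G.half_le_value_r₂]

/-- **Orientation check**: the boundary enters as `−[r₂] + [r₃]` (value at `b` minus value at `a`,
moved to the left-hand side); the opposite sign is refuted. -/
theorem not_wrongSign : ¬ WrongSign := by
  intro h
  have key : KZ.of G.r₁ + KZ.of G.r₂ - KZ.of G.r₃ + KZ.of G.r₄ ∈ KZ.relations :=
    G.spec (P := fun {_} r₁ r₂ r₃ r₄ => KZ.of r₁ + KZ.of r₂ - KZ.of r₃ + KZ.of r₄ ∈ KZ.relations) h
  have h0 := KZ.relations_le_ker_eval_holds key
  simp only [AddMonoidHom.mem_ker, map_add, map_sub, KZ.eval_of, G.value_r₁, G.value_r₃] at h0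
  linarith [G.half_le_value_r₂, G.half_le_value_r₄]


end Summit.KontsevichZagierPeriods.LiouvilleUnfolding.UnfoldedLogStokesNegative
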